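import Literature.IUT.HodgeTheaters.Cor53iiBadSlotLiftsAllAtStandIn
import Literature.IUT.HodgeTheaters.Cor53iiBadSlotSummandLifts
import HarnessLib

/-!
# [IUTchI] Cor 5.3 (ii) bad slot at OUR stand-in (B) — `hlift@hull` = `LiftsAll` IS A THEOREM SUMMAND-WISE: the [EtTh]-content hull
# `𝒞_v̲ = C_{A₀}^{bs-fld} ⊕ 𝒞⊢_v̲` lifts every transporter on BOTH summands (the constant [EtTh] summand tautologically, `𝒞⊢_v̲` by descent) (proof-only)

S. Mochizuki, *Inter-universal Teichmüller theory I*, kurims manuscript (May 2020), §5 Cor. 5.3 (ii) p. 144 l. 12–15 («`Isom(¹𝔉, ²𝔉) → Isom(¹𝔇, ²𝔇)`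
is bijective») and the argument printed for (iv), p. 144 l. 37–40 («surjectivity follows immediately from the construction of `ℱ̲_v`»); Ex. 3.2 (iii) p. 71
(`𝒞_v ⊆ ℱ̲_v` the base-field-theoretic hull) ([IUTchI] Cor 5.3 (ii) p.144) [claim: Mochizuki2012, status: disputed] (D-0012 claim key; nothing of the
series is asserted; no side is taken on [IUTchIII] Cor. 3.12).  S. Mochizuki, *The étale theta function …* [MochizukiEtTh2009], Def. 3.6 (ii)/(iv)
pp. 303–304 (PDF pp. 77–78) [cite: MochizukiEtTh2009, Def 3.6 p.77]; *The geometry of Frobenioids I*, Thm. 5.2 (i) p. 100 [cite: MochizukiFrdI2008, Thm. 5.2(i) p.100].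

PROOF-ONLY (cell abc-iut, seat abc-iut-L5-t4 gen 8, KEY R72 «COR53II-BAD-SLOT-LAWS@STAND-IN» part (3), file (L2); sequel of ★ `Cor53iiBadSlotLiftsAllAtStandIn`
(stand-in (A)) at THE Θ-side stand-in of record (B) abc-iut-L2-t7 ★ p510136 `badTemperedSideOfThetaTower`: `𝒞_v̲ := C_{A₀}^{bs-fld} ⊕ 𝒞⊢_v̲`, `C_{A₀}` =
abc-iut-L2-t6's CONSTANT re-basing ★ `TemperedFrobenioid.constRebase` of the ε-free theta tower's [EtTh] Def. 3.6 (ii) tempered Frobenioid over `𝒟_v̲`).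
WHAT THIS FILE PROVES (theorems only; 0 `def` · 0 `instance` · 0 notation · no `Prop` fact · no sorry):
* INPUTS BY NAME: ★ `TemperedFrobenioid.exists_constRebase_hull_lift` (the TAUTOLOGICAL lift of every base self-equivalence to the hull of a
  CONSTANT re-basing — all pull-backs identities) and ★ `CatIsomorphism.exists_sum_lift` (summand lifts assemble), both ★ `Cor53iiBadSlotSummandLifts`;
  (L1)'s ★ `Cor53ii.exists_cdashLift_under_transporter` (the `𝒞⊢_v̲`-lift under a transporter, by descent + [IUTchI] Cor 5.3 (iii)).
* **`Cor53ii.liftsAll_hull_ofGroupDataThetaTower (… m2 m4 hTFG A₀ x hx) (hT)`** — `LiftsAll` at ★ `badStructureFunctor` for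
  `I := MergeInputs.ofGroupDataThetaTower D B m2 m4 hTFG A₀` under the DISPLAYED `hT` (genuine (m2) augmentation): summand `C_{A₀}^{bs-fld}` by the
  tautological lift read through `inl ⋙ hull ⋙ toBase ≅ Base` (`Functor.inlCompSum'` twice), summand `𝒞⊢_v̲` by (L1) read through ★ `cdashBaseIso`,
  assembled on the sum; records of record with `hT` DISCHARGED: **`Cor53ii.liftsAll_hull_standIn`** (`mergeInputsThetaTowerStandIn hA CG hTFG A₀`,
  ★ `rhoAt_m2StandIn_aug`) and `Cor53ii.liftsAll_hull_ofClosed` (`MergeInputs.thetaTowerOfClosed`, ★ `rhoAt_m2OfClosed_aug`).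
TOGETHER WITH ★ p534998 (`Cor53ii.not_kernelTrivial_hull_standIn`): at THE Θ-side stand-in of record the (ii) bad slot reads «hlift PROVED (summand-wise) ·
hker REFUTED-AS-TYPED · by-name TM-pair form = INPUT-SHAPE (lane 2)».  CENSUS: binders = the kit's own {`CG`, `hS`, `M`, `hA`, `hI`, `B`, `ΛBad`,
`Fact l.Prime`} ∪ the record's {`m2`, `m4`, `hTFG`, `A₀`} / {`hA`, `CG`, `hTFG`, `A₀`} / {`hH`, `hTFG`, `A₀`} ∪ {`x`, `hx`} ∪ the DISPLAYED `hT` (discharged at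
the records of record); LAW 0 · FACT 0.  HONEST: a lift on a CONSTANT summand carries no arithmetic; OURS at OUR stand-in; print's surjectivity argument
([AbsTopIII] Thm 1.9 at `ℬ^temp(X̲̲_v)⁰`) is not this; typed ≠ inhabited ≠ proved; no token is moved by this file; nothing here asserts abc proved or refuted.
-/

noncomputable section

open CategoryTheory Opposite

/-! ### The lift at stand-in (B): `hlift@hull` for the [EtTh]-content records, summand-wise -/

namespace Literature.IUT.HodgeTheaters

namespace Cor53ii

open InitialThetaData Literature.AnabelianGeometry.SemiGraphs Literature.AlgebraicGeometry.Frobenioids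
  Literature.AlgebraicGeometry.Frobenioids.PadicFrd Literature.AnabelianGeometry.EtaleTheta

variable {F K Fbar : Type} [Field F] [NumberField F] [Field K] [NumberField K] [Algebra F K]
  [Field Fbar] [Algebra F Fbar] [Algebra K Fbar] {E : WeierstrassCurve F}
  [E.IsElliptic] {l : ℕ} {Pb : BadPlacePredicates K} (D : InitialThetaData F K Fbar E l Pb)
  (CG : D.geom.pe.CuspGalois) (hS : D.CuspClassesNormaliserStable) [Fact l.Prime] (M : D.TorsionMonodromy)
  (hA : D.geom.pe.ArrowCoveringClaims) (hI : ∀ k ∈ D.geom.pe.inertia D.geom.pe.ε1, M.tau (D.geom.embK k) = 0)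
  (B : ∀ v, v ∈ D.indexCopyBad → D.BadPairAt v) (ΛBad : ∀ v (h : v ∈ D.indexCopyBad), D.LocalArrowLaw CG hS (B v h).H)
  (m2 : ∀ x (hx : x ∈ D.indexCopyBad), BadLocalGroupDatum (D.GalAt x (D.not_mem_arc_of_mem_bad hx)) ↥(B x hx).H)
  (m4 : RealifiedGlobalSide) (hTFG : D.geom.extF.GeomTFG) (A₀ : ConnectedPart (BTemp TateTowerKummerTwistRShear.Compat₃'))
  (x : D.IndexCopy) (hx : x ∈ D.indexCopyBad)

/-- **`hlift@hull` IS A THEOREM at stand-in (B), SUMMAND-WISE.**  For the merge record `I := MergeInputs.ofGroupDataThetaTower D B m2 m4 hTFG A₀`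
(hull `𝒞_v̲ := C_{A₀}^{bs-fld} ⊕ 𝒞⊢_v̲`) and a (m2) whose augmentation is the GENUINE one (`hT`, DISPLAYED), `LiftsAll` at the `ℱ`-slot of the bad index
`x` (★ `badLiftAt_model_case_iff`) HOLDS over the genuine §6 base kit of record: every `E ∘ conj_n ∘ E⁻¹` lifts to the CONSTANT [EtTh] summand
tautologically (★ `exists_constRebase_hull_lift`) and to `𝒞⊢_v̲` by descent (★ `exists_cdashLift_under_transporter`), and the two lifts assemble
(★ `exists_sum_lift`) through the `inl`- and `inr`-
read-outs of `hull ⋙ toBase` (★ `Functor.inlCompSum'`, abc-iut-L2-t6 ★ `cdashBaseIso`).  OURS, at OUR stand-in; print's (ii) surjectivity argument is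
[AbsTopIII] Thm 1.9 at `ℬ^temp(X̲̲_v)⁰`, not this. ([IUTchI] Cor 5.3 (ii) p.144) [claim: Mochizuki2012, status: disputed] -/
theorem liftsAll_hull_ofGroupDataThetaTower
    (hT : ∀ h : ↥(B x hx).H, D.rhoAt x (D.not_mem_arc_of_mem_bad hx) ((m2 x hx).aug h) = D.augGF h) :
    CatIsomorphism.LiftsAll
      (D.badStructureFunctor CG hS M hA hI B ΛBad (MergeInputs.ofGroupDataThetaTower D B m2 m4 hTFG A₀) x hx)
      ((D.baseKitThetaNFOfBadPairs CG hS M hA hI B ΛBad).model x) (D.modelAutToCatAut CG hS M hA hI B ΛBad x) := by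
  haveI : Fact (D.primeAt x (D.not_mem_arc_of_mem_bad hx)).Prime := D.fact_primeAt_prime x _
  refine (D.badLiftsAllAt_iff CG hS M hA hI B ΛBad (MergeInputs.ofGroupDataThetaTower D B m2 m4 hTFG A₀) x hx).2 fun n => ?_
  refine CatIsomorphism.exists_sum_lift _ _ ?_ ?_
  · -- the CONSTANT [EtTh] summand `C_{A₀}^{bs-fld}`: the tautological lift, read through `inl ⋙ hull ⋙ toBase ≅ Base`
    obtain ⟨ΨX, ⟨jX⟩⟩ := (ThetaTwistTowerTempered.temperedFrobenioid (fun _ => True) (fun _ => True)).exists_constRebase_hull_lift A₀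
      (CosetCat ↥(B x hx).H) CosetCat.isConnected CosetCat.isTotallyEpimorphic (fun _ => True) (fun _ => True)
      (((D.badBaseEquiv CG hS M hA hI B ΛBad x hx).trans
        (PiTransport.conjSelfEquiv ((D.localDataOfBadPairs CG hS M hA hI B ΛBad x).H) n)).trans (D.badBaseEquiv CG hS M hA hI B ΛBad x hx).symm)
    let i : Sum.inl_ _ _ ⋙ ThetaInputOfThetaTower.hull (m2 x hx) (D.qRootAtIdx_not_isUnit x hx) (fun _ => True) (fun _ => True) A₀ ⋙
          ThetaInputOfThetaTower.toBase (m2 x hx) (D.qRootAtIdx_not_isUnit x hx) (fun _ => True) (fun _ => True) A₀ ≅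
        ModelFrobenioid.baseFunctor _ _ (ThetaInputOfThetaTower.frd (P := ↥(B x hx).H) (fun _ => True) (fun _ => True) A₀).divFNatTrans :=
      (Functor.associator _ _ _).symm ≪≫ Functor.isoWhiskerRight (Functor.inlCompSum' _ _) _ ≪≫ Functor.associator _ _ _ ≪≫
        Functor.isoWhiskerLeft _ (Functor.inlCompSum' _ _)
    exact ⟨ΨX, ⟨Functor.isoWhiskerLeft ΨX.functor i ≪≫ jX ≪≫ Functor.isoWhiskerRight i.symm _⟩⟩
  · -- the `𝒞⊢_v̲` summand: descent + [IUTchI] Cor 5.3 (iii) (★ `exists_cdashLift_under_transporter`), read through `cdashBaseIso`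
    obtain ⟨ΨY, ⟨jY⟩⟩ := exists_cdashLift_under_transporter D CG hS M hA hI B ΛBad x hx (MergeInputs.ofGroupDataThetaTower D B m2 m4 hTFG A₀) hT n
    let i := ThetaInputOfThetaTower.cdashBaseIso (m2 x hx) (D.qRootAtIdx_not_isUnit x hx) (fun _ => True) (fun _ => True) A₀
    exact ⟨ΨY, ⟨Functor.isoWhiskerLeft ΨY.functor i ≪≫ jY ≪≫ Functor.isoWhiskerRight i.symm _⟩⟩

/-- **HEADLINE (B): `hlift@hull` IS A THEOREM at THE Θ-side stand-in of record** `D.mergeInputsThetaTowerStandIn hA CG hTFG A₀` (abc-iut-L2-t7 ★ p510136;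
(m2) = `m2StandIn`, GENUINE augmentation — `rhoAt`-compatible by ★ `rhoAt_m2StandIn_aug`): over the genuine §6 base kit of the `X̲→`-stand-in family,
`LiftsAll` at the `ℱ`-slot of EVERY bad index.  With ★ p534998 (`not_kernelTrivial_hull_standIn`): there the model-case map is SURJECTIVE, NOT injective.
([IUTchI] Cor 5.3 (ii) p.144) [claim: Mochizuki2012, status: disputed] -/
theorem liftsAll_hull_standIn (ΛBad' : ∀ v (h : v ∈ D.indexCopyBad), D.LocalArrowLaw CG hS (D.badPairAtArrow hA v).H) :
    CatIsomorphism.LiftsAll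
      (D.badStructureFunctor CG hS M hA hI (fun v _ => D.badPairAtArrow hA v) ΛBad' (D.mergeInputsThetaTowerStandIn hA CG hTFG A₀) x hx)
      ((D.baseKitThetaNFOfBadPairs CG hS M hA hI (fun v _ => D.badPairAtArrow hA v) ΛBad').model x)
      (D.modelAutToCatAut CG hS M hA hI (fun v _ => D.badPairAtArrow hA v) ΛBad' x) :=
  haveI : Fact (D.primeAt x (D.not_mem_arc_of_mem_bad hx)).Prime := D.fact_primeAt_prime x _
  liftsAll_hull_ofGroupDataThetaTower D CG hS M hA hI (fun v _ => D.badPairAtArrow hA v) ΛBad' _ _ hTFG A₀ x hx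
    (fun h => D.rhoAt_m2StandIn_aug hA CG x (D.not_mem_arc_of_mem_bad hx) hTFG h)

/-- **`hlift@hull` at EVERY CLOSED bad-pair family with the [EtTh]-content (m1)** (`MergeInputs.thetaTowerOfClosed D B hH hTFG A₀`, abc-iut-L2-t7
★ p510136 §4; (m2) = `m2OfClosed`, `rhoAt`-compatible by ★ `rhoAt_m2OfClosed_aug`): `LiftsAll` at the `ℱ`-slot of every bad index, NO side condition.
([IUTchI] Cor 5.3 (ii) p.144) [claim: Mochizuki2012, status: disputed] -/
theorem liftsAll_hull_ofClosed (hH : ∀ x (hx : x ∈ D.indexCopyBad), IsClosed ((B x hx).H : Set D.PiC)) :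
    CatIsomorphism.LiftsAll
      (D.badStructureFunctor CG hS M hA hI B ΛBad (MergeInputs.thetaTowerOfClosed D B hH hTFG A₀) x hx)
      ((D.baseKitThetaNFOfBadPairs CG hS M hA hI B ΛBad).model x) (D.modelAutToCatAut CG hS M hA hI B ΛBad x) :=
  liftsAll_hull_ofGroupDataThetaTower D CG hS M hA hI B ΛBad _ _ hTFG A₀ x hx (D.rhoAt_m2OfClosed_aug B x hx (hH x hx))

end Cor53ii

end Literature.IUT.HodgeTheaters

end
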